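import Summits.Ventures.PercRepro.SixFourIdentities
import Summits.Ventures.PercRepro.PlaneCore

/-!
# The `t = 3` clause of `SixFourResidue` — demand-free cases

`J₃(G) = Σ_{B ∈ R₄(G)} 3·w_∞(B) − (6/5)·(N₄ − DF₃)`, where `DF₃` counts the rank-`4` subsets `B ⊆ G` whose rest `G ∖ B`
has rank `≤ 2`.  When every rank-`4` subset is demand-free (`DF₃ = N₄`) the balance is `3·Σ w_∞ ≥ 0`
(`J_three_nonneg_of_demandFree`).  This happens for `g ≤ 6`: a rank-`4` subset has `≥ 4` points, so the rest has `≤ 2`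
points and rank `≤ 2` (`J_three_nonneg_of_card_le_six`).  The mirror of `SixFourResidueSmallCases` at `t = 3`.
-/

namespace PercRepro.SixFour

open Finset ThmH

variable {α : Type*} [DecidableEq α] {M : Matroid α} [M.Finite] {G : Finset α}

/-- **The demand-free case at `t = 3`**: if every rank-`4` subset of `G` leaves a rest of rank `≤ 2`, then `0 ≤ J₃(G)`. -/
theorem J_three_nonneg_of_demandFree (h : ∀ B ∈ R4 M G, M.eRk ((G \ B : Finset α) : Set α) ≤ 2) :
    0 ≤ J M G 3 := by
  have hDF : DF M G 3 = N4 M G := by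
    unfold DF N4
    congr 1
    apply Finset.filter_true_of_mem
    intro B hB
    have h2 := h B hB
    calc M.eRk ((G \ B : Finset α) : Set α) + 1 ≤ 2 + 1 := add_le_add_left h2 1
      _ = ((3 : ℕ) : ℕ∞) := by norm_num
  unfold J
  rw [hDF, sub_self, mul_zero, sub_zero]
  apply Finset.sum_nonneg
  intro B _
  have := wInf_pos (M := M) B
  norm_num
  linarith

omit [DecidableEq α] [M.Finite] in
/-- A finset of at most `2` points has rank `≤ 2`. -/
theorem eRk_le_two_of_card_le {X : Finset α} (hX : X.card ≤ 2) : M.eRk (X : Set α) ≤ 2 := by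
  have h := M.eRk_le_encard (X : Set α)
  rw [Set.encard_coe_eq_coe_finsetCard] at h
  exact h.trans (by exact_mod_cast hX)

/-- **`g ≤ 6` at `t = 3`**: a rank-`4` subset has `≥ 4` points, so the rest has `≤ 2` points and rank `≤ 2`. -/
theorem J_three_nonneg_of_card_le_six (hg : G.card ≤ 6) : 0 ≤ J M G 3 := by
  apply J_three_nonneg_of_demandFree
  intro B hB
  obtain ⟨hBG, hr⟩ := mem_R4.1 hB
  have h4 := four_le_card_of_eRk_eq_four hr
  apply eRk_le_two_of_card_le
  rw [Finset.card_sdiff_of_subset hBG]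
  omega

end PercRepro.SixFour
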